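import Literature.Analysis.FunctionSpaces.PVToolkit
import HarnessLib

/-!
# `PV`-definable functions, II: sharply bounded quantification, minimisation, sequences

Topic `Literature/Analysis/FunctionSpaces` (continuation of `PVToolkit.lean`).  Further closure properties
of Cobham's class `𝓛` (`IsPVDefinable`, the standard interpretations of Cook's `PV` symbols) used by
the witnessing direction of Buss's Main Theorem: the characteristic functions of sharply bounded
quantifiers `∀ z ≤ |s|`, `∃ z ≤ |s|` over a definable test, the sharply bounded `μ`-operator
(Buss 1986, Ch. 1: `□ᵖ₁` is closed under sharply bounded quantification and minimisation;
Cobham 1965), and fixed-width sequence coding: the digit function `⌊w / 2^{i·b}⌋ mod 2ᵇ` and the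
*collecting* function `x⃗ ↦ Σ_{z ≤ |s x⃗|} min (g(x⃗, z)) (t x⃗) · 2^{z·(|t x⃗|+1)}` together with its
decoding lemma `digit_collectVal` (the function witnessing sharply bounded collection `BB`,
Buss 1986, §2.5–2.7; Krajíček 1995, Lemma 5.2.12).

## Main results (all `theorem`s; no named facts)

* `IsPVDefinable.allLen`, `IsPVDefinable.exLen`, `IsPVDefinable.muLen` (with the semantic values
  `allBelow`, `muBelow` and their API `muBelow_le`, `eq_zero_of_lt_muBelow`, `ne_zero_muBelow`,
  `muBelow_lt_iff`, `muBelow_eq_of`);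
* `IsPVDefinable.digit`, `sum_digit_div_mod` (decoding base-`2ᵇ` expansions), `collectVal`,
  `IsPVDefinable.collect`, `digit_collectVal`, `collectVal_lt`.

## References

* A. Cobham, *The intrinsic computational difficulty of functions*, 1965.
* S. R. Buss, *Bounded Arithmetic*, Bibliopolis 1986, Ch. 1, §2.5.
* J. Krajíček, *Bounded Arithmetic, Propositional Logic and Complexity Theory*, CUP 1995, §5.2
  (Lemma 5.2.12), §5.4.

## Design choices

* As in `PVToolkit.lean`, every recursion is on the notation of a ruler `r`; to range over
  `z ≤ |s|` (`|s| + 1` values) the ruler `2s + 1` of length `|s| + 1` is used.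
* `muBelow P x k` takes the value `k` ("not found") when no `z < k` passes the test, as in
  Buss 1986, Ch. 1.
-/

namespace Literature.Analysis.FunctionSpaces

open PVFun

variable {n m : ℕ}

/-! ## Sharply bounded quantification and minimisation -/

section Bounded

variable {P : (Fin (n + 1) → ℕ) → ℕ} {S : (Fin n → ℕ) → ℕ}

/-- `allBelow P x k = [∀ z < k, P(x, z) ≠ 0]` (the value of a sharply bounded universal
quantifier over a `0/1`-valued test). [cite: Buss1986, Ch. 1] -/
noncomputable def allBelow (P : (Fin (n + 1) → ℕ) → ℕ) (x : Fin n → ℕ) (k : ℕ) : ℕ := by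
  classical exact if ∀ z < k, P (Fin.snoc x z) ≠ 0 then 1 else 0

/-- One more test. [folklore] -/
theorem allBelow_succ (P : (Fin (n + 1) → ℕ) → ℕ) (x : Fin n → ℕ) (k : ℕ) :
    allBelow P x (k + 1) = allBelow P x k * if P (Fin.snoc x k) = 0 then 0 else 1 := by
  unfold allBelow
  by_cases h1 : ∀ z < k, P (Fin.snoc x z) ≠ 0
  · by_cases h2 : P (Fin.snoc x k) = 0
    · rw [if_pos h1, if_pos h2, if_neg]
      exact fun h => h k (Nat.lt_succ_self k) h2
    · rw [if_pos h1, if_neg h2, if_pos]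
      intro z hz
      rcases (Nat.lt_succ_iff_lt_or_eq).1 hz with hz | rfl
      · exact h1 z hz
      · exact h2
  · rw [if_neg h1, if_neg, zero_mul]
    exact fun h => h1 fun z hz => h z (Nat.lt_succ_of_lt hz)

/-- The sharply bounded universal quantifier by recursion on the notation of a ruler: after
`|r|` steps the accumulated product is `[∀ z < |r|, P(x, z) ≠ 0]` (Buss 1986, Ch. 1: `□ᵖ₁` is
closed under sharply bounded quantification; Cobham 1965). [cite: Buss1986, Ch. 1] -/
theorem recN_allBelow (x : Fin n → ℕ) (r : ℕ) :
    recN (fun _ => 1) (fun _ x y acc => acc * if P (Fin.snoc x y.size) = 0 then 0 else 1)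
      (fun _ _ => 1) x r = allBelow P x r.size := by
  induction r using Nat.binaryRec' with
  | zero => simp [allBelow]
  | bit b y hy ih =>
    rw [recN_bit _ _ _ _ _ _ hy, ih, size_bit_of_imp hy, ← allBelow_succ]
    refine min_eq_left ?_
    unfold allBelow
    split_ifs <;> simp

/-- The coordinates of `(x⃗, y, acc) ↦ x⃗` are definable. [folklore] -/
theorem IsPVDefinable.init_init_coord (i : Fin n) :
    IsPVDefinable fun v : Fin (n + 2) → ℕ => (Fin.init (Fin.init v) : Fin n → ℕ) i :=
  (IsPVDefinable.proj i.castSucc.castSucc).of_eq fun _ => rfl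

/-- **Cobham's class is closed under sharply bounded universal quantification**: for a definable
test `P(x⃗, z)` and bound `S(x⃗)`, the characteristic function of `∀ z ≤ |S x⃗|, P(x⃗, z) ≠ 0` is
definable (Buss 1986, Ch. 1; Bennett 1962 / Cobham 1965). [cite: Buss1986, Ch. 1] -/
theorem IsPVDefinable.allLen (hP : IsPVDefinable P) (hS : IsPVDefinable S) :
    IsPVDefinable fun x => if ∀ z ≤ (S x).size, P (Fin.snoc x z) ≠ 0 then 1 else 0 := by
  classical
  have h1 : IsPVDefinable fun v : Fin (n + 1) → ℕ =>
      recN (fun _ => 1) (fun _ x y acc => acc * if P (Fin.snoc x y.size) = 0 then 0 else 1)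
        (fun _ _ => 1) (Fin.init v) (v (Fin.last n)) := by
    refine IsPVDefinable.of_recN (.const 1) (fun _ => ?_) (.const 1)
    refine (IsPVDefinable.proj (Fin.last (n + 1))).mul ((hP.compVec ?_).cond (.const 0) (.const 1))
    exact IsPVDefinable.snoc_coord IsPVDefinable.init_init_coord
      (IsPVDefinable.proj (Fin.last n).castSucc).len
  refine (h1.compVec (w := fun x => Fin.snoc x (Nat.bit true (S x)))
    (IsPVDefinable.snoc_coord IsPVDefinable.proj (hS.bit true))).of_eq fun x => ?_
  simp only [Fin.init_snoc, Fin.snoc_last, recN_allBelow,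
    size_bit_of_imp (b := true) (y := S x) (fun _ => rfl)]
  unfold allBelow
  simp only [Nat.lt_succ_iff]

/-- **Cobham's class is closed under sharply bounded existential quantification.**
[cite: Buss1986, Ch. 1] -/
theorem IsPVDefinable.exLen (hP : IsPVDefinable P) (hS : IsPVDefinable S) :
    IsPVDefinable fun x => if ∃ z ≤ (S x).size, P (Fin.snoc x z) ≠ 0 then 1 else 0 := by
  classical
  refine ((hP.sg.allLen hS).sg).of_eq fun x => ?_
  by_cases h : ∃ z ≤ (S x).size, P (Fin.snoc x z) ≠ 0
  · rw [if_pos h, if_pos]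
    rw [if_neg]
    push Not
    obtain ⟨z, hz, hPz⟩ := h
    exact ⟨z, hz, by rw [if_neg hPz]⟩
  · rw [if_neg h, if_neg]
    rw [if_pos]
    · exact one_ne_zero
    · intro z hz
      rw [if_pos (not_not.1 fun hPz => h ⟨z, hz, hPz⟩)]
      exact one_ne_zero

/-- `muBelow P x k`: the least `z < k` with `P(x, z) ≠ 0`, and `k` if there is none (the value of
the sharply bounded `μ`-operator) (Buss 1986, Ch. 1). [cite: Buss1986, Ch. 1] -/
noncomputable def muBelow (P : (Fin (n + 1) → ℕ) → ℕ) (x : Fin n → ℕ) (k : ℕ) : ℕ := by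
  classical exact if h : ∃ z, z < k ∧ P (Fin.snoc x z) ≠ 0 then Nat.find h else k

/-- `muBelow P x k ≤ k`. [cite: Buss1986, Ch. 1] -/
theorem muBelow_le (P : (Fin (n + 1) → ℕ) → ℕ) (x : Fin n → ℕ) (k : ℕ) : muBelow P x k ≤ k := by
  classical
  unfold muBelow
  split_ifs with h
  · exact (Nat.find_spec h).1.le
  · exact le_rfl

/-- Below `muBelow` the test fails. [cite: Buss1986, Ch. 1] -/
theorem eq_zero_of_lt_muBelow {P : (Fin (n + 1) → ℕ) → ℕ} {x : Fin n → ℕ} {k z : ℕ}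
    (hz : z < muBelow P x k) : P (Fin.snoc x z) = 0 := by
  classical
  unfold muBelow at hz
  split_ifs at hz with h
  · by_contra hne
    exact Nat.find_min h hz ⟨hz.trans (Nat.find_spec h).1, hne⟩
  · by_contra hne
    exact h ⟨z, hz, hne⟩

/-- If `muBelow < k` the test holds there. [cite: Buss1986, Ch. 1] -/
theorem ne_zero_muBelow {P : (Fin (n + 1) → ℕ) → ℕ} {x : Fin n → ℕ} {k : ℕ}
    (h : muBelow P x k < k) : P (Fin.snoc x (muBelow P x k)) ≠ 0 := by
  classical
  unfold muBelow at h ⊢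
  split_ifs at h ⊢ with h'
  · exact (Nat.find_spec h').2
  · exact absurd h (lt_irrefl k)

/-- `muBelow < k` iff some `z < k` passes the test. [cite: Buss1986, Ch. 1] -/
theorem muBelow_lt_iff {P : (Fin (n + 1) → ℕ) → ℕ} {x : Fin n → ℕ} {k : ℕ} :
    muBelow P x k < k ↔ ∃ z < k, P (Fin.snoc x z) ≠ 0 := by
  refine ⟨fun h => ⟨_, h, ne_zero_muBelow h⟩, fun ⟨z, hz, hPz⟩ => ?_⟩
  by_contra hk
  exact hPz (eq_zero_of_lt_muBelow (hz.trans_le (not_lt.1 hk)))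

/-- Characterisation of `muBelow` by its defining properties. [cite: Buss1986, Ch. 1] -/
theorem muBelow_eq_of {P : (Fin (n + 1) → ℕ) → ℕ} {x : Fin n → ℕ} {k m : ℕ} (hmk : m ≤ k)
    (hlt : ∀ z < m, P (Fin.snoc x z) = 0) (hm : m < k → P (Fin.snoc x m) ≠ 0) :
    muBelow P x k = m := by
  refine le_antisymm ?_ ?_
  · by_contra h
    rw [not_le] at h
    exact hm (h.trans_le (muBelow_le P x k)) (eq_zero_of_lt_muBelow h)
  · by_contra h
    rw [not_le] at h
    exact ne_zero_muBelow (h.trans_le hmk) (hlt _ h)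

/-- One more candidate. [folklore] -/
theorem muBelow_succ (P : (Fin (n + 1) → ℕ) → ℕ) (x : Fin n → ℕ) (k : ℕ) :
    muBelow P x (k + 1) =
      if muBelow P x k < k then muBelow P x k
      else if P (Fin.snoc x k) = 0 then k + 1 else k := by
  split_ifs with h1 h2
  · exact muBelow_eq_of ((muBelow_le P x k).trans (Nat.le_succ k))
      (fun z hz => eq_zero_of_lt_muBelow hz) (fun _ => ne_zero_muBelow h1)
  · have hk : muBelow P x k = k := le_antisymm (muBelow_le P x k) (not_lt.1 h1)
    refine muBelow_eq_of le_rfl (fun z hz => ?_) (fun h => absurd h (lt_irrefl _))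
    rcases (Nat.lt_succ_iff_lt_or_eq).1 hz with hz | rfl
    · exact eq_zero_of_lt_muBelow (hz.trans_le hk.ge)
    · exact h2
  · have hk : muBelow P x k = k := le_antisymm (muBelow_le P x k) (not_lt.1 h1)
    exact muBelow_eq_of (Nat.le_succ k) (fun z hz => eq_zero_of_lt_muBelow (hz.trans_le hk.ge))
      (fun _ => h2)

/-- The sharply bounded `μ`-operator by recursion on the notation of a ruler (Buss 1986, Ch. 1:
`□ᵖ₁` is closed under sharply bounded minimisation). [cite: Buss1986, Ch. 1] -/
theorem recN_muBelow (x : Fin n → ℕ) (r : ℕ) :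
    recN (fun _ => 0)
      (fun _ x y acc => if acc < y.size then acc else if P (Fin.snoc x y.size) = 0
        then y.size + 1 else y.size)
      (fun _ y => y.size) x r = muBelow P x r.size := by
  induction r using Nat.binaryRec' with
  | zero =>
    rw [recN_zero, Nat.size_zero, Nat.min_zero]
    exact (muBelow_eq_of le_rfl (fun z hz => absurd hz (Nat.not_lt_zero z))
      (fun h => absurd h (lt_irrefl 0))).symm
  | bit b y hy ih =>
    rw [recN_bit _ _ _ _ _ _ hy, ih, size_bit_of_imp hy, ← muBelow_succ]
    exact min_eq_left (muBelow_le P x _)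

/-- **Cobham's class is closed under sharply bounded minimisation**: for a definable test
`P(x⃗, z)` and bound `S(x⃗)`, the function `x⃗ ↦ μ z ≤ |S x⃗| [P(x⃗, z) ≠ 0]` (with value
`|S x⃗| + 1` if there is no such `z`), i.e. `muBelow P x (|S x| + 1)`, is definable
(Buss 1986, Ch. 1; Cobham 1965). [cite: Buss1986, Ch. 1] -/
theorem IsPVDefinable.muLen (hP : IsPVDefinable P) (hS : IsPVDefinable S) :
    IsPVDefinable fun x => muBelow P x ((S x).size + 1) := by
  classical
  have h1 : IsPVDefinable fun v : Fin (n + 1) → ℕ =>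
      recN (fun _ => 0)
        (fun _ x y acc => if acc < y.size then acc else if P (Fin.snoc x y.size) = 0
          then y.size + 1 else y.size)
        (fun _ y => y.size) (Fin.init v) (v (Fin.last n)) := by
    refine IsPVDefinable.of_recN (.const 0) (fun _ => ?_) (IsPVDefinable.proj (Fin.last n)).len
    have hy : IsPVDefinable fun v : Fin (n + 2) → ℕ => (v (Fin.last n).castSucc).size :=
      (IsPVDefinable.proj (Fin.last n).castSucc).len
    refine (IsPVDefinable.proj (Fin.last (n + 1))).ite_lt hy (.proj (Fin.last (n + 1))) ?_
    exact ((hP.compVec (IsPVDefinable.snoc_coord IsPVDefinable.init_init_coord hy)).cond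
      hy.succ hy)
  refine (h1.compVec (w := fun x => Fin.snoc x (Nat.bit true (S x)))
    (IsPVDefinable.snoc_coord IsPVDefinable.proj (hS.bit true))).of_eq fun x => ?_
  simp only [Fin.init_snoc, Fin.snoc_last, recN_muBelow,
    size_bit_of_imp (b := true) (y := S x) (fun _ => rfl)]

end Bounded

/-! ## Fixed-width sequences: digits and collection -/

section Sequences

variable {F G H : (Fin n → ℕ) → ℕ} {g : (Fin (n + 1) → ℕ) → ℕ} {S T : (Fin n → ℕ) → ℕ}

/-- **The digit function is in Cobham's class**: `(w, i, b) ↦ ⌊w / 2^{i·b}⌋ mod 2ᵇ`, the `i`-th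
digit of width `b` bits of `w` (Buss 1986, §2.5, the sequence-decoding function `β`; Krajíček 1995,
§5.4). [cite: Buss1986, §2.5] -/
theorem IsPVDefinable.digit (hF : IsPVDefinable F) (hG : IsPVDefinable G) (hH : IsPVDefinable H) :
    IsPVDefinable fun x => F x / 2 ^ (G x * H x) % 2 ^ H x :=
  (hF.shiftRight (hG.mul hH)).modPow hH

/-- Base-`2ᵇ` expansions: a sum of digits below position `k` is `< 2^{k·b}`. [folklore] -/
theorem sum_digit_mul_pow_lt {d : ℕ → ℕ} {b : ℕ} (hd : ∀ z, d z < 2 ^ b) (k : ℕ) :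
    ∑ z ∈ Finset.range k, d z * 2 ^ (z * b) < 2 ^ (k * b) := by
  induction k with
  | zero => simp
  | succ k ih =>
    rw [Finset.sum_range_succ, Nat.succ_mul, pow_add]
    have h1 := hd k
    have h2 : 1 ≤ 2 ^ (k * b) := Nat.one_le_two_pow
    calc ∑ z ∈ Finset.range k, d z * 2 ^ (z * b) + d k * 2 ^ (k * b)
        < 2 ^ (k * b) + d k * 2 ^ (k * b) := by omega
      _ = (d k + 1) * 2 ^ (k * b) := by ring
      _ ≤ 2 ^ b * 2 ^ (k * b) := Nat.mul_le_mul_right _ h1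
      _ = 2 ^ (k * b) * 2 ^ b := by ring

/-- Base-`2ᵇ` expansions: splitting a sum of digits at position `i`. [folklore] -/
theorem exists_sum_digit_split {d : ℕ → ℕ} {b i k : ℕ} (hik : i < k) :
    ∃ R, ∑ z ∈ Finset.range k, d z * 2 ^ (z * b) =
      ∑ z ∈ Finset.range i, d z * 2 ^ (z * b) + 2 ^ (i * b) * (d i + 2 ^ b * R) := by
  induction k, hik using Nat.le_induction with
  | base => exact ⟨0, by rw [Finset.sum_range_succ]; ring⟩
  | succ k hik ih =>
    obtain ⟨R, hR⟩ := ih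
    obtain ⟨j, rfl⟩ := Nat.exists_eq_add_of_lt hik
    refine ⟨R + d (i + j + 1) * 2 ^ (j * b), ?_⟩
    rw [Finset.sum_range_succ, hR]
    ring

/-- **Decoding a base-`2ᵇ` expansion**: the `i`-th digit of `Σ_{z<k} d(z)·2^{z·b}` is `d(i)`
when all digits are `< 2ᵇ` (Buss 1986, §2.5; Krajíček 1995, §5.4). [cite: Buss1986, §2.5] -/
theorem sum_digit_div_mod {d : ℕ → ℕ} {b i k : ℕ} (hd : ∀ z, d z < 2 ^ b) (hik : i < k) :
    (∑ z ∈ Finset.range k, d z * 2 ^ (z * b)) / 2 ^ (i * b) % 2 ^ b = d i := by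
  obtain ⟨R, hR⟩ := exists_sum_digit_split (d := d) (b := b) hik
  rw [hR, Nat.add_mul_div_left _ _ (by positivity),
    Nat.div_eq_of_lt (sum_digit_mul_pow_lt hd i), zero_add, Nat.add_mul_mod_self_left,
    Nat.mod_eq_of_lt (hd i)]

/-- `collectVal g S T x = Σ_{z ≤ |S x|} min (g(x, z)) (T x) · 2^{z·(|T x|+1)}`: the code of the
sequence of the values `g(x, 0), …, g(x, |S x|)`, truncated at `T x`, in digits of width
`|T x| + 1` (the collecting function used for sharply bounded collection `BB`, Buss 1986,
§2.5–2.7; Krajíček 1995, Lemma 5.2.12). [cite: Buss1986, §2.5] -/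
noncomputable def collectVal (g : (Fin (n + 1) → ℕ) → ℕ) (S T : (Fin n → ℕ) → ℕ)
    (x : Fin n → ℕ) : ℕ :=
  ∑ z ∈ Finset.range ((S x).size + 1), min (g (Fin.snoc x z)) (T x) * 2 ^ (z * ((T x).size + 1))

/-- The truncated values are digits of width `|T x| + 1`. [folklore] -/
theorem min_lt_two_pow_size_succ (a t : ℕ) : min a t < 2 ^ (t.size + 1) :=
  (min_le_right a t).trans_lt (t.lt_size_self.trans (Nat.pow_lt_pow_right one_lt_two (by omega)))

/-- The collecting function by recursion on the notation of a ruler: after `|r|` steps the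
accumulator is `Σ_{z<|r|} min (g(x,z)) (T x) · 2^{z·(|T x|+1)}`. [cite: Buss1986, §2.5] -/
theorem recN_collect (x : Fin n → ℕ) (r : ℕ) :
    recN (fun _ => 0)
      (fun _ x y acc => acc + min (g (Fin.snoc x y.size)) (T x) * 2 ^ (y.size * ((T x).size + 1)))
      (fun x y => 2 ^ (y.size * ((T x).size + 1))) x r =
      ∑ z ∈ Finset.range r.size, min (g (Fin.snoc x z)) (T x) * 2 ^ (z * ((T x).size + 1)) := by
  induction r using Nat.binaryRec' with
  | zero => simp
  | bit b y hy ih =>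
    rw [recN_bit _ _ _ _ _ _ hy, ih, size_bit_of_imp hy, ← Finset.sum_range_succ]
    exact min_eq_left (sum_digit_mul_pow_lt
      (fun z => min_lt_two_pow_size_succ (g (Fin.snoc x z)) (T x)) _).le

/-- **The collecting function is in Cobham's class** (Buss 1986, §2.5–2.7: the function
witnessing sharply bounded collection is polynomial time). [cite: Buss1986, §2.5] -/
theorem IsPVDefinable.collect (hg : IsPVDefinable g) (hS : IsPVDefinable S) (hT : IsPVDefinable T) :
    IsPVDefinable (collectVal g S T) := by
  have hTii : IsPVDefinable fun v : Fin (n + 2) → ℕ => T (Fin.init (Fin.init v)) :=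
    hT.compVec IsPVDefinable.init_init_coord
  have hy : IsPVDefinable fun v : Fin (n + 2) → ℕ => (v (Fin.last n).castSucc).size :=
    (IsPVDefinable.proj (Fin.last n).castSucc).len
  have hpow2 : IsPVDefinable fun v : Fin (n + 2) → ℕ =>
      2 ^ ((v (Fin.last n).castSucc).size * ((T (Fin.init (Fin.init v))).size + 1)) :=
    ((IsPVDefinable.proj (Fin.last n).castSucc).smash (hTii.bit true)).of_eq fun v => by
      rw [size_bit_of_imp (fun _ => rfl)]
  have hpow1 : IsPVDefinable fun v : Fin (n + 1) → ℕ =>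
      2 ^ ((v (Fin.last n)).size * ((T (Fin.init v)).size + 1)) :=
    ((IsPVDefinable.proj (Fin.last n)).smash ((hT.compVec IsPVDefinable.init_coord).bit true)).of_eq
      fun v => by rw [size_bit_of_imp (fun _ => rfl)]
  have h1 : IsPVDefinable fun v : Fin (n + 1) → ℕ =>
      recN (fun _ => 0)
        (fun _ x y acc => acc + min (g (Fin.snoc x y.size)) (T x) * 2 ^ (y.size * ((T x).size + 1)))
        (fun x y => 2 ^ (y.size * ((T x).size + 1))) (Fin.init v) (v (Fin.last n)) := by
    refine IsPVDefinable.of_recN (.const 0) (fun _ => ?_) hpow1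
    exact (IsPVDefinable.proj (Fin.last (n + 1))).add
      (((hg.compVec (IsPVDefinable.snoc_coord IsPVDefinable.init_init_coord hy)).inf hTii).mul
        hpow2)
  refine (h1.compVec (w := fun x => Fin.snoc x (Nat.bit true (S x)))
    (IsPVDefinable.snoc_coord IsPVDefinable.proj (hS.bit true))).of_eq fun x => ?_
  simp only [Fin.init_snoc, Fin.snoc_last, recN_collect,
    size_bit_of_imp (b := true) (y := S x) (fun _ => rfl), collectVal]

/-- **Decoding the collecting function**: for `i ≤ |S x|`, the `i`-th digit of width `|T x| + 1`
of `collectVal g S T x` is `min (g(x, i)) (T x)` (Buss 1986, §2.5). [cite: Buss1986, §2.5] -/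
theorem digit_collectVal (g : (Fin (n + 1) → ℕ) → ℕ) (S T : (Fin n → ℕ) → ℕ) (x : Fin n → ℕ)
    {i : ℕ} (hi : i ≤ (S x).size) :
    collectVal g S T x / 2 ^ (i * ((T x).size + 1)) % 2 ^ ((T x).size + 1) =
      min (g (Fin.snoc x i)) (T x) :=
  sum_digit_div_mod (d := fun z => min (g (Fin.snoc x z)) (T x))
    (fun z => min_lt_two_pow_size_succ (g (Fin.snoc x z)) (T x)) (Nat.lt_succ_of_le hi)

/-- The code of the collected sequence is `< 2^{(|S x|+1)·(|T x|+1)} = (2·S x + 1) # (2·T x + 1)`.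
[cite: Buss1986, §2.5] -/
theorem collectVal_lt (g : (Fin (n + 1) → ℕ) → ℕ) (S T : (Fin n → ℕ) → ℕ) (x : Fin n → ℕ) :
    collectVal g S T x < 2 ^ (((S x).size + 1) * ((T x).size + 1)) :=
  sum_digit_mul_pow_lt (fun z => min_lt_two_pow_size_succ (g (Fin.snoc x z)) (T x)) _

/-- Every digit of the collected sequence is `≤ T x`. [cite: Buss1986, §2.5] -/
theorem digit_collectVal_le (g : (Fin (n + 1) → ℕ) → ℕ) (S T : (Fin n → ℕ) → ℕ) (x : Fin n → ℕ)
    {i : ℕ} (hi : i ≤ (S x).size) :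
    collectVal g S T x / 2 ^ (i * ((T x).size + 1)) % 2 ^ ((T x).size + 1) ≤ T x := by
  rw [digit_collectVal g S T x hi]
  exact min_le_right _ _

end Sequences

end Literature.Analysis.FunctionSpaces
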